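import Summits.ValiantsHypothesis.Statement
import Literature.Computability.AlgebraicComplexity.RazExplicit
import Mathlib.Analysis.SpecialFunctions.Pow.Real

/-!
# ValiantsHypothesis / Elusive — assembly

Route `ValiantsHypothesis/Elusive`, item `stmt-ValiantsHypothesis-0339` (rank-1 assembly).
Hypotheses, in order:

1. Raz's elusive-curve criterion for the permanent (Raz 2010, Theory of Computing 6, abstract and
   §1: "any explicit `f : ℂ → ℂ^m` [that is `(m-1, 2)`-elusive] (with the right notion of
   explicitness), of degree up to `2^{m^{o(1)}}`, implies super-polynomial lower bounds for
   computing the permanent over `ℂ`"), rendered for integer curve families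
   `f m : Fin m → ℤ[x]` with the Turing-machine explicitness `Literature.Computability.AlgebraicComplexity.IsRazExplicit`
   (`RazExplicit.lean`), degree `≤ 2^{m^ε}` eventually for every `ε > 0`, and eventual
   `(m-1, 2)`-elusiveness over `ℂ` (unfolded: no quadratic `Γ : ℂ^{m-1} → ℂ^m` has image
   containing the curve). This is a hypothesis here (a cite/fact item of the route), NOT the
   tree's `Literature.Computability.AlgebraicComplexity.raz_elusive_curve` (whose `IsPolyDefinableMap (m := id)` clause is
   satisfied by every polynomial-degree curve family and is therefore not Raz's explicitness).
2. The route thesis `X_Elusive` (item `stmt-ValiantsHypothesis-0338`): such a family exists.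
3. The renaming bridge `perFamily ℂ ∈ VP ℂ ↔ IsVPFamily (fun n => perPoly (Fin n) ℂ)`.
4. Valiant's theorem `per ∈ VNP` (`Literature.PNP.perFamily_mem_VNP ℂ`).

Conclusion: `ValiantsHypothesis` (`VP ℂ ≠ VNP ℂ`). Pure bookkeeping (1 ∘ 2 gives `per ∉ VP`,
then the hub argument of `Theorems/Hub/Hub.lean`).
-/

namespace Summit.ValiantsHypothesis.Elusive

/-- Settles stmt-ValiantsHypothesis-0339 (assembly of route Elusive): Raz's explicit-elusive-curve
criterion (hypothesis) ∧ thesis X_Elusive ∧ bridge ∧ `per ∈ VNP` ⇒ `ValiantsHypothesis`.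
[folklore] -/
theorem valiantsHypothesis_of_elusive :
    (∀ f : ∀ m : ℕ, Fin m → Polynomial ℤ, Literature.Computability.AlgebraicComplexity.IsRazExplicit f →
        (∀ ε : ℝ, 0 < ε → ∃ m₀ : ℕ, ∀ m ≥ m₀, ∀ i : Fin m,
          ((f m i).natDegree : ℝ) ≤ (2 : ℝ) ^ ((m : ℝ) ^ ε)) →
        (∃ m₀ : ℕ, ∀ m ≥ m₀, ∀ Γ : Fin m → MvPolynomial (Fin (m - 1)) ℂ,
          (∀ i, (Γ i).totalDegree ≤ 2) →
            ¬ (Set.range (fun x : ℂ => fun i : Fin m => Polynomial.aeval x (f m i)) ⊆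
                Set.range (fun y : Fin (m - 1) → ℂ => fun i : Fin m =>
                  MvPolynomial.eval y (Γ i)))) →
        ¬ Literature.Computability.AlgebraicComplexity.IsVPFamily (fun n => Literature.Computability.AlgebraicComplexity.perPoly (Fin n) ℂ)) →
      (∃ f : ∀ m : ℕ, Fin m → Polynomial ℤ, Literature.Computability.AlgebraicComplexity.IsRazExplicit f ∧
        (∀ ε : ℝ, 0 < ε → ∃ m₀ : ℕ, ∀ m ≥ m₀, ∀ i : Fin m,
          ((f m i).natDegree : ℝ) ≤ (2 : ℝ) ^ ((m : ℝ) ^ ε)) ∧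
        (∃ m₀ : ℕ, ∀ m ≥ m₀, ∀ Γ : Fin m → MvPolynomial (Fin (m - 1)) ℂ,
          (∀ i, (Γ i).totalDegree ≤ 2) →
            ¬ (Set.range (fun x : ℂ => fun i : Fin m => Polynomial.aeval x (f m i)) ⊆
                Set.range (fun y : Fin (m - 1) → ℂ => fun i : Fin m =>
                  MvPolynomial.eval y (Γ i))))) →
      (Literature.Computability.AlgebraicComplexity.perFamily ℂ ∈ Literature.Computability.AlgebraicComplexity.VP ℂ ↔
        Literature.Computability.AlgebraicComplexity.IsVPFamily (fun n => Literature.Computability.AlgebraicComplexity.perPoly (Fin n) ℂ)) →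
      Literature.Computability.AlgebraicComplexity.perFamily_mem_VNP ℂ → ValiantsHypothesis := by
  intro hRaz hX hbridge hVNP
  obtain ⟨f, hexp, hdeg, hel⟩ := hX
  show Literature.Computability.AlgebraicComplexity.VP ℂ ≠ Literature.Computability.AlgebraicComplexity.VNP ℂ
  intro hEq
  apply hRaz f hexp hdeg hel
  have hper : Literature.Computability.AlgebraicComplexity.perFamily ℂ ∈ Literature.Computability.AlgebraicComplexity.VP ℂ := by rw [hEq]; exact hVNP
  exact hbridge.1 hper

end Summit.ValiantsHypothesis.Elusive
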